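import Literature.Analysis.FunctionSpaces.BMO
import HarnessLib

/-!
# BMO: discharges of the elementary named facts

Topic `Analysis/FunctionSpaces`; proofs companion of
`Literature/Analysis/FunctionSpaces/BMO.lean`. This file discharges

* `Literature.Analysis.FunctionSpaces.eBMOSeminorm_add_le` — the BMO seminorm is subadditive,
  `‖f + g‖_* ≤ ‖f‖_* + ‖g‖_*` for locally integrable `f, g` on a proper (pseudo-)metric
  measure space (Stein, *Harmonic Analysis* (1993), Ch. IV §1.1: `‖·‖_*` is a norm on `BMO`
  modulo constants; Grafakos, *Modern Fourier Analysis*, 3rd ed., §3.1.1, remark after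
  Definition 3.1.1: "`BMO` is a linear space … `‖f+g‖_{BMO} ≤ ‖f‖_{BMO} + ‖g‖_{BMO}`"):
  `Literature.Analysis.FunctionSpaces.eBMOSeminorm_add_le_holds`;
* its corollary `Literature.Analysis.FunctionSpaces.MemBMO.add` — `BMO` is stable under addition (same sources):
  `Literature.Analysis.FunctionSpaces.MemBMO.add_holds`.
* `Literature.Analysis.FunctionSpaces.eBMOSeminorm_const` — constants have zero BMO seminorm, `‖c‖_* = 0`
  (Stein, *Harmonic Analysis* (1993), Ch. IV §1.1.1: the constants are exactly the null
  elements of `‖·‖_*`, so `BMO` is taken modulo constants; Grafakos, *Modern Fourier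
  Analysis*, 3rd ed., §3.1.1, remark after Definition 3.1.1 (held scan p. 201): "every
  constant function `c` satisfies `‖c‖_{BMO} = 0`"): `Literature.Analysis.FunctionSpaces.eBMOSeminorm_const_holds`
  (re-landed: it first landed alone in this module and was dropped by a later whole-file
  replacement).

## Proof

Fix a ball `B = B(x, r)`. Properness of `X` makes `closedBall x r` compact, so local
integrability gives `f, g ∈ L¹(B, μ)` and the Bochner ball averages add up,
`(f + g)_B = f_B + g_B` (no completeness of `F` is needed: for incomplete `F` all three
averages are the junk value `0`). Pointwise
`‖(f + g) - (f + g)_B‖ₑ ≤ ‖f - f_B‖ₑ + ‖g - g_B‖ₑ`, and the `ℝ≥0∞`-valued ball average `⨍⁻_B`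
is monotone and additive on a.e.-measurable integrands; each of the two resulting mean
oscillations is bounded by the corresponding seminorm
(`Literature.Analysis.FunctionSpaces.laverage_oscillation_le_eBMOSeminorm`), and one takes the supremum over `x`, `r > 0`.
`MemBMO (f + g)` then follows from `LocallyIntegrable.add` and `‖f‖_* + ‖g‖_* < ∞`.

For `eBMOSeminorm_const`: fix a ball `B = B(x, r)` and a constant `c`. If `0 < μ B < ∞`, the
Bochner ball average of `c` is `c` (`MeasureTheory.setAverage_const`; this is where
`[CompleteSpace F]` enters), so the integrand `‖c - c_B‖ₑ` vanishes identically and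
`⨍⁻_B 0 = 0`. If `μ B = 0` then `μ|_B = 0` (`MeasureTheory.Measure.restrict_eq_zero`) and the
outer average is against the zero measure; if `μ B = ∞` then `⨍⁻_B g = (∫⁻_B g) / μ B = 0`
(`MeasureTheory.setLAverage_eq`, `ENNReal.div_top`). In both degenerate cases the mean
oscillation is `0` whatever the inner average is (these are exactly the junk-value conventions
documented at `Literature.Analysis.FunctionSpaces.eBMOSeminorm`); hence the supremum over `x`, `r > 0` is `0`.

## References

* E. M. Stein, *Harmonic Analysis: Real-Variable Methods, Orthogonality, and Oscillatory
  Integrals*, Princeton Math. Series 43 (1993), Ch. IV §1.1 and §1.1.1. [SteinHA1993]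
* L. Grafakos, *Modern Fourier Analysis*, 3rd ed., GTM 250 (2014), §3.1.1, Definition 3.1.1
  and the remark following it (held scan pp. 200–201). [GrafakosMFA2014]
-/

noncomputable section

open MeasureTheory Metric Filter Topology
open scoped ENNReal NNReal

namespace Literature.Analysis.FunctionSpaces

section BMO

variable {X : Type*} [PseudoMetricSpace X] [MeasurableSpace X]
variable {F : Type*} [NormedAddCommGroup F] [NormedSpace ℝ F]

/-- **Subadditivity of the BMO seminorm** (discharge of the named fact
`Literature.Analysis.FunctionSpaces.eBMOSeminorm_add_le`): on a proper pseudo-metric measure space, for locally integrable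
`f, g`, `‖f + g‖_* ≤ ‖f‖_* + ‖g‖_*` (Stein, *Harmonic Analysis* IV.1.1: the BMO norm, `BMO` a
normed space modulo constants; Grafakos, *Modern Fourier Analysis*, 3rd ed., §3.1.1, remark
after Def. 3.1.1: `‖f+g‖_{BMO} ≤ ‖f‖_{BMO} + ‖g‖_{BMO}`). [cite: SteinHA1993, IV.1.1] -/
theorem eBMOSeminorm_add_le_holds : eBMOSeminorm_add_le (X := X) (F := F) := by
  intro _ f g μ hf hg
  refine iSup_le fun x => iSup₂_le fun r hr => ?_
  have hfB : IntegrableOn f (ball x r) μ :=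
    (hf.integrableOn_isCompact (isCompact_closedBall x r)).mono_set ball_subset_closedBall
  have hgB : IntegrableOn g (ball x r) μ :=
    (hg.integrableOn_isCompact (isCompact_closedBall x r)).mono_set ball_subset_closedBall
  -- the Bochner ball averages add up (junk value `0` on both sides if `F` is not complete)
  have havg : ⨍ z in ball x r, (f + g) z ∂μ =
      (⨍ z in ball x r, f z ∂μ) + ⨍ z in ball x r, g z ∂μ := by
    simp only [setAverage_eq, Pi.add_apply, integral_add hfB hgB, smul_add]
  have hfm : AEMeasurable (fun y => ‖f y - ⨍ z in ball x r, f z ∂μ‖ₑ) (μ.restrict (ball x r)) :=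
    (hfB.aestronglyMeasurable.sub aestronglyMeasurable_const).enorm
  calc ⨍⁻ y in ball x r, ‖(f + g) y - ⨍ z in ball x r, (f + g) z ∂μ‖ₑ ∂μ
      ≤ ⨍⁻ y in ball x r,
          (‖f y - ⨍ z in ball x r, f z ∂μ‖ₑ + ‖g y - ⨍ z in ball x r, g z ∂μ‖ₑ) ∂μ := by
        refine setLAverage_mono_ae _ (Eventually.of_forall fun y => ?_)
        dsimp only
        rw [havg, Pi.add_apply, add_sub_add_comm]
        exact enorm_add_le _ _
    _ = (⨍⁻ y in ball x r, ‖f y - ⨍ z in ball x r, f z ∂μ‖ₑ ∂μ) +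
          ⨍⁻ y in ball x r, ‖g y - ⨍ z in ball x r, g z ∂μ‖ₑ ∂μ := by
        rw [setLAverage_eq, setLAverage_eq, setLAverage_eq, ← ENNReal.add_div,
          lintegral_add_left' hfm]
    _ ≤ eBMOSeminorm f μ + eBMOSeminorm g μ :=
        add_le_add (laverage_oscillation_le_eBMOSeminorm f μ x hr)
          (laverage_oscillation_le_eBMOSeminorm g μ x hr)

/-- **`BMO` is stable under addition** (discharge of the named fact `Literature.Analysis.FunctionSpaces.MemBMO.add`): on a
proper pseudo-metric measure space, `f, g ∈ BMO ⇒ f + g ∈ BMO` (Stein, *Harmonic Analysis*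
IV.1.1; Grafakos, *Modern Fourier Analysis*, 3rd ed., §3.1.1, remark after Def. 3.1.1: `BMO` is
a linear space). Immediate from `eBMOSeminorm_add_le_holds` and `LocallyIntegrable.add`.
[cite: SteinHA1993, IV.1.1] -/
theorem MemBMO.add_holds : MemBMO.add (X := X) (F := F) :=
  fun hf hg =>
    ⟨hf.locallyIntegrable.add hg.locallyIntegrable,
      (eBMOSeminorm_add_le_holds hf.locallyIntegrable hg.locallyIntegrable).trans_lt
        (ENNReal.add_lt_top.2 ⟨hf.eBMOSeminorm_lt_top, hg.eBMOSeminorm_lt_top⟩)⟩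

/-- **Constants have zero BMO seminorm** (discharge of the named fact
`Literature.Analysis.FunctionSpaces.eBMOSeminorm_const`): for `F` complete, `‖fun _ => c‖_* = 0` for every `c : F` and every
measure `μ` (Stein, *Harmonic Analysis* IV.1.1.1: the constants are the null elements of
`‖·‖_*`, so `BMO` is taken modulo constants; Grafakos, *Modern Fourier Analysis*, 3rd ed.,
§3.1.1, remark after Def. 3.1.1: "every constant function `c` satisfies `‖c‖_{BMO} = 0`"). Here
balls replace cubes and `μ` is arbitrary. On a ball `B = B(x,r)` with `0 < μ B < ∞` the average of
the constant `c` is `c` (`MeasureTheory.setAverage_const`, using `[CompleteSpace F]`), so the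
integrand `‖c - c_B‖ₑ` vanishes; if `μ B = 0` or `μ B = ∞` the outer average `⨍⁻_B` is taken
against the measure `(μ B)⁻¹ • μ|_B = 0` and is `0` regardless of the inner average.
[cite: SteinHA1993, IV.1.1.1 (BMO modulo constants)] -/
theorem eBMOSeminorm_const_holds : eBMOSeminorm_const (X := X) (F := F) := by
  intro _ c μ
  simp only [eBMOSeminorm, ENNReal.iSup_eq_zero]
  intro x r _
  rcases eq_or_ne (μ (ball x r)) 0 with h0 | h0
  · rw [Measure.restrict_eq_zero.2 h0, laverage_zero_measure]
  rcases eq_or_ne (μ (ball x r)) ∞ with htop | htop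
  · rw [setLAverage_eq, htop, ENNReal.div_top]
  · rw [setAverage_const h0 htop]
    simp

end BMO

end Literature.Analysis.FunctionSpaces
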